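import Literature.Topology.FourManifolds.TrisectionsTubeFrame
import Literature.Topology.FourManifolds.TrisectionsBeltModel
import Literature.Topology.FourManifolds.TrisectionsMiddleCharts
import HarnessLib

/-!
# The Morse function of the handlebody `H₂₃`: the profiles, the core zones of the `2`-handles,
# the modified transported Heegaard function, and its reading in Milnor's charts

Topic `Literature/Topology/FourManifolds`; for the fact seat
`provefact-Literature.Topology.FourManifolds.exists_isBalancedGKTrisection` (Gay–Kirby 2016,
Thm. 4 via §4, Lemma 14).  Everything in this file is **proved**; the definitions are explicit
functions and sets.

Over a tube frame `𝔉 : T.TubeFrame ι` (`TrisectionsTubeFrame.lean`) and belt parameters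
`𝔓 : 𝔉.BeltParams`, the Morse function of the handlebody `H₂₃ = X₂ ∩ X₃` is the restriction of
the ambient function

  `F = 1 - α(f - a) + β · Ĝ`,

where `α` (`TriData.alpha`) is a smooth profile with `α(s) = s` near `0`, `α' > 0` below the
plateau height `c - a - 5ε/12` and `α` constant above it, and `Ĝ` (`BeltParams.Ghat`) is the
transported Heegaard function `G = g ∘ λ - b` **modified on the core zones**
`Z_j = {x ∈ source_j | A_j x < a_R, |f x - c| < m₁}` of the `2`-handles into the explicit
recipe `k_g 𝒯̂(coord_j) + g₀ - b - (τ'/β) χ₂(A) χ₃(B) y₀/√B` (`BeltParams.recipe`; `𝒯̂` the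
tube function with its angular term capped by `ρ̂ = χ/A`, the last term the symmetry-breaking
perturbation of `TrisectionsBeltModel.lean`).  Proved here:

* properties of the profiles `α`, `χ`, `ρ̂`, `χ₂`, `χ₃` (plateaus, derivatives, smoothness —
  `contDiff_rhoHat` glues `χ/A` with `0` across the flat zone of `χ`);
* the zones are open, pairwise disjoint, inside the boxes and the thin tubes, and meet `H₂₃`
  along the lid (`BeltParams.f_eq_c_of_mem_H₂₃_of_mem_zone`);
* **shell agreement** `recipe = G` on `{max r₁ r₃ < A_j}` (`recipe_eq_gFun_of_lt_A`: there
  `ρ̂ = 1/A`, `χ₂ = 0`, and `G = k_g 𝒯 + g₀ - b` by `TubeFrame.gFun_eq_of_P_lt`), hence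
  **`Ĝ` and `F` are smooth at every point of `H₂₃`** (`contMDiffAt_Famb_of_mem_H₂₃`);
* **the reading in Milnor's chart**: on `Z_j ∩ {B_j > ν²/2}`,
  `F = C_j + belt K ε_T (κ_T/η₂) τ' ρ̂ χ₂ (coord_j ·)` with `K = β k_g`
  (`Famb_eq_of_mem_zone`), the belt function of `TrisectionsBeltModel.lean`.

## References

* D. Gay, R. Kirby, *Trisecting 4-manifolds*, Geom. Topol. 20 (2016), §4, Lemma 14. [GayKirby2016]
* J. Milnor, *Lectures on the h-cobordism theorem* (1965), Def. 3.1. [MilnorHCobordism1965]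
* J. Milnor, *Morse theory* (1963), §2–§3. [Milnor1963]
-/

open scoped Manifold ContDiff Topology
open Set Function Filter Real

noncomputable section

universe u

namespace Literature.Topology.FourManifolds

open Flow

variable {X : Type u} [TopologicalSpace X] [T2Space X] [CompactSpace X]
  [ChartedSpace (EuclideanSpace ℝ (Fin 4)) X] [IsManifold (𝓡 4) ∞ X]

namespace BiCollar

namespace TriData

variable {B : BiCollar X} (T : B.TriData)

/-! ### The height profile `α` -/

/-- The plateau centre of `α`: `S = c - a - ε/2`. [folklore] -/
def αS : ℝ := T.c - B.a - T.ε / 2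

/-- The crease width of `α`: `ε/12`. [folklore] -/
def ασ : ℝ := T.ε / 12

/-- **The height profile** `α(s) = S - σ_{ε/12}(S - s)`: `α(s) = s` for `s ≤ S - ε/12`,
`α = S` for `s ≥ S + ε/12`, `0 ≤ α' ≤ 1`, `α' > 0` for `s < S + ε/12`. [folklore] -/
def alpha (s : ℝ) : ℝ := T.αS - creaseσ T.ασ (T.αS - s)

omit [T2Space X] [CompactSpace X] in
/-- `ε/12 > 0`. [folklore] -/
theorem ασ_pos : 0 < T.ασ := by unfold ασ; linarith [T.ε_pos]

omit [T2Space X] [CompactSpace X] in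
/-- `ε ≤ c - a`. [folklore] -/
theorem ε_le_sub : T.ε ≤ T.c - B.a := by linarith [T.ε_le, T.D.εw_pos]

omit [T2Space X] [CompactSpace X] in
/-- `α(s) = s` below the plateau: `s ≤ S - ε/12`. [folklore] -/
theorem alpha_of_le {s : ℝ} (hs : s ≤ T.αS - T.ασ) : T.alpha s = s := by
  unfold alpha
  rw [creaseσ_of_le T.ασ_pos (by linarith)]
  ring

omit [T2Space X] [CompactSpace X] in
/-- `α(0) = 0`. [folklore] -/
theorem alpha_zero : T.alpha 0 = 0 :=
  T.alpha_of_le (by unfold αS ασ; linarith [T.ε_le_sub, T.ε_pos])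

omit [T2Space X] [CompactSpace X] in
/-- `α = S` on the plateau: `S + ε/12 ≤ s`. [folklore] -/
theorem alpha_of_ge {s : ℝ} (hs : T.αS + T.ασ ≤ s) : T.alpha s = T.αS := by
  unfold alpha
  rw [creaseσ_of_le_neg T.ασ_pos (by linarith)]
  ring

omit [T2Space X] [CompactSpace X] in
/-- `α` is smooth. [folklore] -/
theorem contDiff_alpha : ContDiff ℝ ∞ T.alpha :=
  contDiff_const.sub ((contDiff_creaseσ T.ασ).comp (contDiff_const.sub contDiff_id))

omit [T2Space X] [CompactSpace X] in
/-- The derivative of `α`: `α'(s) = step((S - s)/(ε/12))`. [folklore] -/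
theorem hasDerivAt_alpha (s : ℝ) : HasDerivAt T.alpha (creaseStep ((T.αS - s) / T.ασ)) s := by
  have h1 : HasDerivAt (fun s => creaseσ T.ασ (T.αS - s)) (-creaseStep ((T.αS - s) / T.ασ)) s :=
    (hasDerivAt_creaseσ T.ασ_pos (T.αS - s)).comp_const_sub T.αS s
  have h2 := h1.const_sub T.αS
  exact h2.congr_deriv (by ring)

omit [T2Space X] [CompactSpace X] in
/-- `0 ≤ α' ≤ 1`. [folklore] -/
theorem deriv_alpha_mem (s : ℝ) : deriv T.alpha s ∈ Icc (0 : ℝ) 1 := by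
  rw [(T.hasDerivAt_alpha s).deriv]
  exact ⟨creaseStep_nonneg _, creaseStep_le_one _⟩

omit [T2Space X] [CompactSpace X] in
/-- `α' > 0` below the end of the plateau transition: `s < S + ε/12`. [folklore] -/
theorem deriv_alpha_pos {s : ℝ} (hs : s < T.αS + T.ασ) : 0 < deriv T.alpha s := by
  rw [(T.hasDerivAt_alpha s).deriv]
  exact creaseStep_pos (by rw [lt_div_iff₀ T.ασ_pos]; linarith)

omit [T2Space X] [CompactSpace X] in
/-- `α' = 0` on the plateau. [folklore] -/
theorem deriv_alpha_of_ge {s : ℝ} (hs : T.αS + T.ασ ≤ s) : deriv T.alpha s = 0 := by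
  rw [(T.hasDerivAt_alpha s).deriv]
  exact creaseStep_of_le_neg_one (by rw [div_le_iff₀ T.ασ_pos]; linarith)

omit [T2Space X] [CompactSpace X] in
/-- `α` is monotone. [folklore] -/
theorem monotone_alpha : Monotone T.alpha :=
  monotone_of_deriv_nonneg (T.contDiff_alpha.differentiable (by simp)) fun s => (T.deriv_alpha_mem s).1

omit [T2Space X] [CompactSpace X] in
/-- `α > 0` on `(0, ∞)`. [folklore] -/
theorem alpha_pos {s : ℝ} (hs : 0 < s) : 0 < T.alpha s := by
  -- `α` is strictly increasing near `0` (`α = id` there)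
  have h0 : T.ασ ≤ T.αS - T.ασ := by unfold αS ασ; linarith [T.ε_le_sub, T.ε_pos]
  rcases le_or_gt s (T.αS - T.ασ) with h | h
  · rw [T.alpha_of_le h]; exact hs
  · have h1 : T.alpha (T.αS - T.ασ) ≤ T.alpha s := T.monotone_alpha h.le
    rw [T.alpha_of_le le_rfl] at h1
    linarith [T.ασ_pos]

omit [T2Space X] [CompactSpace X] in
/-- `α ≥ 0` on `[0, ∞)`. [folklore] -/
theorem alpha_nonneg {s : ℝ} (hs : 0 ≤ s) : 0 ≤ T.alpha s := by
  rw [← T.alpha_zero]; exact T.monotone_alpha hs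

namespace TubeFrame

variable {T} {ι : Type} [Fintype ι] (𝔉 : T.TubeFrame ι)

/-! ### Frame-level profiles and coordinates -/

/-- **The perturbation cut-off in `B`**: `0` on `(-∞, ν²/4]`, `1` on `[ν²/2, ∞)`. [folklore] -/
def chi3 (Bv : ℝ) : ℝ := smoothTransition ((Bv - 𝔉.ν ^ 2 / 4) / (𝔉.ν ^ 2 / 4))

omit [T2Space X] [CompactSpace X] in
/-- `χ₃ = 0` on `(-∞, ν²/4]`. [folklore] -/
theorem chi3_of_le {Bv : ℝ} (hB : Bv ≤ 𝔉.ν ^ 2 / 4) : 𝔉.chi3 Bv = 0 :=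
  smoothTransition.zero_of_nonpos (div_nonpos_of_nonpos_of_nonneg (by linarith) (by positivity))

omit [T2Space X] [CompactSpace X] in
/-- `χ₃ = 1` on `[ν²/2, ∞)`. [folklore] -/
theorem chi3_of_ge {Bv : ℝ} (hB : 𝔉.ν ^ 2 / 2 ≤ Bv) : 𝔉.chi3 Bv = 1 :=
  smoothTransition.one_of_one_le ((one_le_div (by have := 𝔉.ν_pos; positivity)).2 (by linarith))

omit [T2Space X] [CompactSpace X] in
/-- `0 ≤ χ₃ ≤ 1`. [folklore] -/
theorem chi3_mem (Bv : ℝ) : 𝔉.chi3 Bv ∈ Icc (0 : ℝ) 1 := ⟨smoothTransition.nonneg _, smoothTransition.le_one _⟩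

omit [T2Space X] [CompactSpace X] in
/-- `χ₃` is smooth. [folklore] -/
theorem contDiff_chi3 : ContDiff ℝ ∞ 𝔉.chi3 :=
  smoothTransition.contDiff.comp ((contDiff_id.sub contDiff_const).div_const _)

omit [T2Space X] [CompactSpace X] in
/-- `A_j = qA ∘ coord_j`. [folklore] -/
theorem A_eq_qA (j : ι) (x : X) : 𝔉.boxes.A j x = BeltModel.qA ((𝔉.boxes.box j).coord x) := by
  rw [HandleBoxes.A_def, 𝔉.boxes.k_eq j, sqSumLT_two_apply, BeltModel.qA_apply]

omit [T2Space X] [CompactSpace X] in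
/-- `B_j = qB ∘ coord_j`. [folklore] -/
theorem B_eq_qB (j : ι) (x : X) : 𝔉.boxes.B j x = BeltModel.qB ((𝔉.boxes.box j).coord x) := by
  rw [HandleBoxes.B_def, 𝔉.boxes.k_eq j, sqSumGE_two_apply, BeltModel.qB_apply]

omit [T2Space X] [CompactSpace X] in
/-- The coordinate `coord_j` is smooth on the chart domain (into the model vector space). [folklore] -/
theorem contMDiffAt_coord {j : ι} {x : X} (hx : x ∈ (𝔉.boxes.box j).chart.source) :
    ContMDiffAt (𝓡 4) 𝓘(ℝ, EuclideanSpace ℝ (Fin 4)) ∞ (𝔉.boxes.box j).coord x :=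
  (𝔉.boxes.box j).contMDiffAt_coord hx

/-! ### Belt parameters and the cut-off profiles -/

/-- **Belt parameters** over a tube frame: the radius `a_R` of the core zones, the radii
`r₀ < r₁` of the transition of the cap `ρ̂ = χ/A` (`χ = 0` on `[0, r₀]`, `= 1` on `[r₁, ∞)`),
the radii `r₂ < r₃` of the cut-off `χ₂` of the perturbation (`= 1` on `[0, r₂]`, `= 0` on
`[r₃, ∞)`), the height window `m₁` of the zones, the size `τ'` of the perturbation and the
coefficient `β > 0` of `Ĝ` in the Morse function; with the size constraints making the zones
lie in the boxes and the thin tubes, the height window lie in the plateau of `α`, and the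
bi-collar box miss the zones. [cite: GayKirby2016, §4, Lemma 14] -/
structure BeltParams where
  /-- The radius (in `A`) of the core zones. -/
  aR : ℝ
  /-- The inner radius of the cap transition. -/
  r₀ : ℝ
  /-- The outer radius of the cap transition. -/
  r₁ : ℝ
  /-- The inner radius of the perturbation cut-off. -/
  r₂ : ℝ
  /-- The outer radius of the perturbation cut-off. -/
  r₃ : ℝ
  /-- The height window of the zones. -/
  m₁ : ℝ
  /-- The size of the perturbation. -/
  τp : ℝ
  /-- The coefficient of `Ĝ`. -/
  β : ℝ
  r₀_pos : 0 < r₀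
  r₀_lt : r₀ < r₁
  r₂_pos : 0 < r₂
  r₂_lt : r₂ < r₃
  r₁_lt : r₁ < aR
  r₃_lt : r₃ < aR
  /-- The zones lie in the boxes. -/
  aR_le : aR ≤ 𝔉.η₂
  m₁_pos : 0 < m₁
  /-- The height window lies in the plateau of `α` (and in the rounding-free zone). -/
  m₁_le_ε : m₁ ≤ T.ε / 4
  /-- The height window is small against the lid. -/
  m₁_le_ν : m₁ ≤ 𝔉.ν ^ 2 / 2
  /-- The zones lie in the thin tubes. -/
  aR_P : aR * (𝔉.ν ^ 2 + m₁ + aR) ≤ 𝔉.P₀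
  τp_pos : 0 < τp
  β_pos : 0 < β
  /-- The bi-collar box misses the zones. -/
  εw_lt : T.D.εw < 𝔉.m₀
  /-- The Heegaard function's constants: on the attaching circles `g = k_g 𝒯 + g₀ ≤ b - m₀` with
  `𝒯 ≥ 1 - ε_T`. -/
  kg_g₀_le : 𝔉.kg * (1 - 𝔉.εT) + 𝔉.g₀ ≤ B.b - 𝔉.m₀
  /-- The corrections are small against the margin. -/
  small₀ : 𝔉.kg * 𝔉.εT + 𝔉.kg * (𝔉.κT / 𝔉.η₂) * 𝔉.P₀ + τp / β ≤ 𝔉.m₀ / 2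
  /-- A bound of the slope of the cap profile `χ`. -/
  L : ℝ
  /-- `χ' ≤ L`. -/
  deriv_chi_le : ∀ A, deriv (fun A => smoothTransition ((A - r₀) / (r₁ - r₀))) A ≤ L
  /-- A bound of the slope of the cut-off `χ₂`. -/
  L₂ : ℝ
  /-- `|χ₂'| ≤ L₂`. -/
  abs_deriv_chi2_le : ∀ A, |deriv (fun A => 1 - smoothTransition ((A - r₂) / (r₃ - r₂))) A| ≤ L₂
  /-- The angular corrections are small against the radial term on the belt level
  (`K ε_T L + τ L₂ < K k₁ ν²` with `K = β k_g`, `k₁ = κ_T/η₂`, divided by `β`). -/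
  small₁ : 𝔉.kg * 𝔉.εT * L + τp / β * L₂ < 𝔉.kg * (𝔉.κT / 𝔉.η₂) * 𝔉.ν ^ 2

namespace BeltParams

variable {𝔉} (𝔓 : 𝔉.BeltParams)

/-- **The cap profile** `χ`: `0` on `(-∞, r₀]`, `1` on `[r₁, ∞)`, monotone, smooth. [folklore] -/
def chi (A : ℝ) : ℝ := smoothTransition ((A - 𝔓.r₀) / (𝔓.r₁ - 𝔓.r₀))

/-- **The capped angular weight** `ρ̂ = χ/A`: `0` near `A = 0`, `1/A` on `[r₁, ∞)`. [cite: GayKirby2016, §4, Lemma 14] -/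
def rhoHat (A : ℝ) : ℝ := 𝔓.chi A / A

/-- **The perturbation cut-off in `A`**: `1` on `(-∞, r₂]`, `0` on `[r₃, ∞)`. [folklore] -/
def chi2 (A : ℝ) : ℝ := 1 - smoothTransition ((A - 𝔓.r₂) / (𝔓.r₃ - 𝔓.r₂))

omit [T2Space X] [CompactSpace X] in
/-- `χ = 0` on `(-∞, r₀]`. [folklore] -/
theorem chi_of_le {A : ℝ} (hA : A ≤ 𝔓.r₀) : 𝔓.chi A = 0 :=
  smoothTransition.zero_of_nonpos (div_nonpos_of_nonpos_of_nonneg (by linarith) (by linarith [𝔓.r₀_lt]))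

omit [T2Space X] [CompactSpace X] in
/-- `χ = 1` on `[r₁, ∞)`. [folklore] -/
theorem chi_of_ge {A : ℝ} (hA : 𝔓.r₁ ≤ A) : 𝔓.chi A = 1 :=
  smoothTransition.one_of_one_le ((one_le_div (by linarith [𝔓.r₀_lt])).2 (by linarith))

omit [T2Space X] [CompactSpace X] in
/-- `χ` is smooth. [folklore] -/
theorem contDiff_chi : ContDiff ℝ ∞ 𝔓.chi :=
  smoothTransition.contDiff.comp ((contDiff_id.sub contDiff_const).div_const _)

omit [T2Space X] [CompactSpace X] in
/-- `0 ≤ χ ≤ 1`. [folklore] -/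
theorem chi_mem (A : ℝ) : 𝔓.chi A ∈ Icc (0 : ℝ) 1 := ⟨smoothTransition.nonneg _, smoothTransition.le_one _⟩

omit [T2Space X] [CompactSpace X] in
/-- `χ` is monotone. [folklore] -/
theorem monotone_chi : Monotone 𝔓.chi := fun _ _ h =>
  smoothTransition.monotone ((div_le_div_iff_of_pos_right (by linarith [𝔓.r₀_lt])).2 (by linarith))

omit [T2Space X] [CompactSpace X] in
/-- `ρ̂ = 0` on `(-∞, r₀]`. [folklore] -/
theorem rhoHat_of_le {A : ℝ} (hA : A ≤ 𝔓.r₀) : 𝔓.rhoHat A = 0 := by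
  rw [rhoHat, 𝔓.chi_of_le hA, zero_div]

omit [T2Space X] [CompactSpace X] in
/-- `ρ̂ = 1/A` on `[r₁, ∞)`. [folklore] -/
theorem rhoHat_of_ge {A : ℝ} (hA : 𝔓.r₁ ≤ A) : 𝔓.rhoHat A = A⁻¹ := by
  rw [rhoHat, 𝔓.chi_of_ge hA, one_div]

omit [T2Space X] [CompactSpace X] in
/-- **`ρ̂` is smooth**: it is `χ/A` on `{A > r₀/2}` and `0` on `{A < r₀}`. [folklore] -/
theorem contDiff_rhoHat : ContDiff ℝ ∞ 𝔓.rhoHat := by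
  have hr := 𝔓.r₀_pos
  refine contDiff_iff_contDiffAt.2 fun A => ?_
  rcases lt_or_ge A 𝔓.r₀ with h | h
  · -- near `A`, `ρ̂ = 0`
    have hev : 𝔓.rhoHat =ᶠ[𝓝 A] fun _ => 0 := by
      filter_upwards [(isOpen_lt continuous_id continuous_const).mem_nhds h] with A' hA'
      exact 𝔓.rhoHat_of_le (le_of_lt hA')
    exact contDiffAt_const.congr_of_eventuallyEq hev
  · have hA : A ≠ 0 := by linarith
    exact 𝔓.contDiff_chi.contDiffAt.div contDiffAt_id hA

omit [T2Space X] [CompactSpace X] in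
/-- `χ₂ = 1` on `(-∞, r₂]`. [folklore] -/
theorem chi2_of_le {A : ℝ} (hA : A ≤ 𝔓.r₂) : 𝔓.chi2 A = 1 := by
  rw [chi2, smoothTransition.zero_of_nonpos (div_nonpos_of_nonpos_of_nonneg (by linarith) (by linarith [𝔓.r₂_lt]))]
  ring

omit [T2Space X] [CompactSpace X] in
/-- `χ₂ = 0` on `[r₃, ∞)`. [folklore] -/
theorem chi2_of_ge {A : ℝ} (hA : 𝔓.r₃ ≤ A) : 𝔓.chi2 A = 0 := by
  rw [chi2, smoothTransition.one_of_one_le ((one_le_div (by linarith [𝔓.r₂_lt])).2 (by linarith))]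
  ring

omit [T2Space X] [CompactSpace X] in
/-- `0 ≤ χ₂ ≤ 1`. [folklore] -/
theorem chi2_mem (A : ℝ) : 𝔓.chi2 A ∈ Icc (0 : ℝ) 1 := by
  have h1 := smoothTransition.nonneg ((A - 𝔓.r₂) / (𝔓.r₃ - 𝔓.r₂))
  have h2 := smoothTransition.le_one ((A - 𝔓.r₂) / (𝔓.r₃ - 𝔓.r₂))
  exact ⟨by unfold chi2; linarith, by unfold chi2; linarith⟩

omit [T2Space X] [CompactSpace X] in
/-- `ρ̂ ≥ 0` on `[0, ∞)`. [folklore] -/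
theorem rhoHat_nonneg {A : ℝ} (hA : 0 ≤ A) : 0 ≤ 𝔓.rhoHat A :=
  div_nonneg (𝔓.chi_mem A).1 hA

omit [T2Space X] [CompactSpace X] in
/-- `χ₂` is smooth. [folklore] -/
theorem contDiff_chi2 : ContDiff ℝ ∞ 𝔓.chi2 :=
  contDiff_const.sub (smoothTransition.contDiff.comp ((contDiff_id.sub contDiff_const).div_const _))

/-! ### The core zones -/

/-- **The core zone of the `j`-th `2`-handle**: `{x ∈ source_j | A_j x < a_R, |f x - c| < m₁}`.
[cite: GayKirby2016, §4, Lemma 14] -/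
def zone (j : ι) : Set X :=
  {x | x ∈ (𝔉.boxes.box j).chart.source ∧ 𝔉.boxes.A j x < 𝔓.aR ∧ |B.f x - T.c| < 𝔓.m₁}

omit [T2Space X] [CompactSpace X] in
/-- Membership in the zone. [folklore] -/
theorem mem_zone {j : ι} {x : X} :
    x ∈ 𝔓.zone j ↔ x ∈ (𝔉.boxes.box j).chart.source ∧ 𝔉.boxes.A j x < 𝔓.aR ∧ |B.f x - T.c| < 𝔓.m₁ :=
  Iff.rfl

omit [T2Space X] [CompactSpace X] in
/-- The zone is open. [folklore] -/
theorem isOpen_zone (j : ι) : IsOpen (𝔓.zone j) := by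
  have h1 : IsOpen {x | x ∈ (𝔉.boxes.box j).chart.source ∧ 𝔉.boxes.A j x < 𝔓.aR} :=
    (𝔉.boxes.continuousOn_A j).isOpen_inter_preimage (𝔉.boxes.box j).chart.open_source isOpen_Iio
  have h2 : IsOpen {x : X | |B.f x - T.c| < 𝔓.m₁} :=
    isOpen_lt (continuous_abs.comp (B.U.contMDiff_f.continuous.sub continuous_const)) continuous_const
  have : 𝔓.zone j = {x | x ∈ (𝔉.boxes.box j).chart.source ∧ 𝔉.boxes.A j x < 𝔓.aR} ∩ {x | |B.f x - T.c| < 𝔓.m₁} := by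
    ext x; simp only [zone, mem_setOf_eq, mem_inter_iff, and_assoc]
  rw [this]
  exact h1.inter h2

omit [T2Space X] [CompactSpace X] in
/-- The zones are pairwise disjoint (the chart domains are). [folklore] -/
theorem zone_disjoint {i j : ι} (hij : i ≠ j) : Disjoint (𝔓.zone i) (𝔓.zone j) :=
  Set.disjoint_left.2 fun _ hi hj => Set.disjoint_left.1 (𝔉.boxes.disjoint hij) hi.1 hj.1

omit [T2Space X] [CompactSpace X] in
/-- Height bounds on the zone: `c - m₁ < f < c + m₁`. [folklore] -/
theorem f_bounds_of_mem_zone {j : ι} {x : X} (hx : x ∈ 𝔓.zone j) :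
    T.c - 𝔓.m₁ < B.f x ∧ B.f x < T.c + 𝔓.m₁ := by
  have h := abs_lt.1 hx.2.2; constructor <;> linarith [h.1, h.2]

omit [T2Space X] [CompactSpace X] in
/-- On the zone, `a - η₂ < f < a + 2η₂`. [folklore] -/
theorem band_of_mem_zone {j : ι} {x : X} (hx : x ∈ 𝔓.zone j) :
    B.a - 𝔉.η₂ < B.f x ∧ B.f x < B.a + 2 * 𝔉.η₂ := by
  obtain ⟨h1, h2⟩ := 𝔓.f_bounds_of_mem_zone hx
  have hc := 𝔉.c_eq
  have := 𝔓.m₁_le_ν; have := 𝔉.two_nu_sq_le; have := 𝔉.η₂_pos; have := 𝔉.ν_pos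
  constructor <;> nlinarith

omit [T2Space X] [CompactSpace X] in
/-- On the zone, `B_j ≤ ν² + m₁ + A_j`. [folklore] -/
theorem B_le_of_mem_zone {j : ι} {x : X} (hx : x ∈ 𝔓.zone j) :
    𝔉.boxes.B j x ≤ 𝔉.ν ^ 2 + 𝔓.m₁ + 𝔉.boxes.A j x := by
  have h1 := 𝔉.boxes.apply_eq hx.1
  have h2 := (𝔓.f_bounds_of_mem_zone hx).2
  rw [𝔉.c_eq] at h2
  linarith

omit [T2Space X] [CompactSpace X] in
/-- **The zone lies in the thin tube**: `P_j < P₀`. [folklore] -/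
theorem P_lt_of_mem_zone {j : ι} {x : X} (hx : x ∈ 𝔓.zone j) : 𝔉.boxes.P j x < 𝔉.P₀ := by
  have hA0 := 𝔉.boxes.A_nonneg j x
  have hB0 := 𝔉.boxes.B_nonneg j x
  have hB := 𝔓.B_le_of_mem_zone hx
  have hA := hx.2.1
  rw [HandleBoxes.P_def]
  calc 𝔉.boxes.A j x * 𝔉.boxes.B j x ≤ 𝔉.boxes.A j x * (𝔉.ν ^ 2 + 𝔓.m₁ + 𝔉.boxes.A j x) :=
        mul_le_mul_of_nonneg_left hB hA0
    _ < 𝔓.aR * (𝔉.ν ^ 2 + 𝔓.m₁ + 𝔓.aR) := by nlinarith [𝔉.ν_pos, 𝔓.m₁_pos]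
    _ ≤ 𝔉.P₀ := 𝔓.aR_P

omit [T2Space X] [CompactSpace X] in
/-- **The zone lies in the (open) box**. [folklore] -/
theorem mem_box_of_mem_zone {j : ι} {x : X} (hx : x ∈ 𝔓.zone j) : x ∈ (𝔉.boxes.box j).box := by
  have hε := 𝔉.boxes.eta_lt j
  have hB := 𝔓.B_le_of_mem_zone hx
  have := 𝔓.aR_le; have := 𝔓.m₁_le_ν; have := 𝔉.two_nu_sq_le; have := 𝔉.η₂_pos
  refine ⟨hx.1, ?_, ?_⟩
  · show 𝔉.boxes.A j x < (𝔉.boxes.box j).ε ^ 2; linarith [hx.2.1]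
  · show 𝔉.boxes.B j x < 4 * (𝔉.boxes.box j).ε ^ 2; nlinarith [hx.2.1]

omit [T2Space X] [CompactSpace X] in
/-- The zone lies in the closed box, a closed subset of the chart domain. [folklore] -/
theorem zone_subset_closedBox (j : ι) :
    𝔓.zone j ⊆ {q' | q' ∈ (𝔉.boxes.box j).chart.source ∧
      sqSumLT (𝔉.boxes.box j).k ((𝔉.boxes.box j).coord q') ≤ (𝔉.boxes.box j).ε ^ 2 ∧
      sqSumGE (𝔉.boxes.box j).k ((𝔉.boxes.box j).coord q') ≤ 4 * (𝔉.boxes.box j).ε ^ 2} :=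
  fun _ hx => (𝔉.boxes.box j).box_subset_closedBox (𝔓.mem_box_of_mem_zone hx)

omit [CompactSpace X] in
/-- A point outside the chart domain has a neighbourhood missing the zone. [folklore] -/
theorem eventually_not_mem_zone_of_not_mem_source {j : ι} {p : X} (hp : p ∉ (𝔉.boxes.box j).chart.source) :
    ∀ᶠ x in 𝓝 p, x ∉ 𝔓.zone j := by
  have hcl : p ∉ closure (𝔓.zone j) := fun h =>
    hp ((closure_minimal (𝔓.zone_subset_closedBox j) (𝔉.boxes.box j).isClosed_closedBox h).1)
  rw [mem_closure_iff_nhds, not_forall] at hcl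
  obtain ⟨N, hN⟩ := hcl
  rw [Classical.not_imp] at hN
  filter_upwards [hN.1] with x hx hxz
  exact hN.2 ⟨x, hx, hxz⟩

/-- **A zone point with `A_j > 0` hits the level** (the non-hitting band points are the unstable
discs `A = 0`). [cite: MilnorHCobordism1965, Thm. 3.4, proof of Thm. 3.12] -/
theorem hit_of_mem_zone_of_A_pos {j : ι} {x : X} (hx : x ∈ 𝔓.zone j) (hA : 0 < 𝔉.boxes.A j x) : B.Hit x := by
  obtain ⟨hf₁, hf₂⟩ := 𝔓.band_of_mem_zone hx
  rcases 𝔉.boxes.hits_or_exists_A_eq_zero (hξ := 𝔉.hζ) 𝔉.hgl T.Fr.isMorse hf₁ hf₂ with h | ⟨j', hbox, hA'⟩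
  · exact (𝔉.hit_iff x).2 h
  · exfalso
    by_cases hjj : j' = j
    · subst hjj; exact hA.ne' hA'
    · exact Set.disjoint_left.1 (𝔉.boxes.disjoint hjj) hbox.1 hx.1

/-- **The zones meet `H₂₃` along the lid**: a point of `H₂₃` in a zone has `f = c`. [cite: GayKirby2016, §4, Lemma 14] -/
theorem f_eq_c_of_mem_H₂₃_of_mem_zone {j : ι} {x : X} (hH : x ∈ T.H₂₃) (hx₁ : x ∉ T.X₁) (hx : x ∈ 𝔓.zone j) :
    B.f x = T.c :=
  𝔉.f_eq_c_of_mem_H₂₃_of_P_lt hH hx₁ hx.1 (𝔓.P_lt_of_mem_zone hx)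

/-- **The belt points lie in the zones**: a non-hitting point of `H₂₃ ∖ X₁` lies in some zone,
with `A_j = 0`. [cite: GayKirby2016, §4, Lemma 14] -/
theorem exists_mem_zone_of_not_hit {x : X} (hH : x ∈ T.H₂₃) (hx₁ : x ∉ T.X₁) (hh : ¬ B.Hit x) :
    ∃ j, x ∈ 𝔓.zone j ∧ 𝔉.boxes.A j x = 0 := by
  have hfc : B.f x = T.c := T.f_eq_c_of_mem_H₂₃ 𝔉.two_mul_ε_le 𝔉.linkCondition hH hx₁ hh
  have hf₁ : B.a - 𝔉.η₂ < B.f x := by rw [hfc]; linarith [𝔉.a_lt_c, 𝔉.η₂_pos]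
  have hf₂ : B.f x < B.a + 2 * 𝔉.η₂ := by rw [hfc]; exact 𝔉.c_lt
  rcases 𝔉.boxes.hits_or_exists_A_eq_zero (hξ := 𝔉.hζ) 𝔉.hgl T.Fr.isMorse hf₁ hf₂ with h | ⟨j, hbox, hA⟩
  · exact absurd ((𝔉.hit_iff x).2 h) hh
  · refine ⟨j, ⟨hbox.1, ?_, ?_⟩, hA⟩
    · rw [hA]; linarith [𝔓.r₁_lt, 𝔓.r₀_lt, 𝔓.r₀_pos]
    · rw [hfc, sub_self, abs_zero]; exact 𝔓.m₁_pos

/-- **The bi-collar box misses the zones**: a point of the box lies in no zone (box points hit,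
with `|G| < ε_w < m₀`, while hitting zone points have `G ≤ -m₀`). [folklore] -/
theorem not_mem_zone_of_mem_box {x : X} (hx : x ∈ B.box T.D.εw) (j : ι) : x ∉ 𝔓.zone j := fun hz => by
  have hh : B.Hit x := T.hit_of_mem_box hx
  obtain ⟨hf₁, hf₂⟩ := 𝔓.band_of_mem_zone hz
  have hG := 𝔉.gFun_le_of_P_lt hz.1 (𝔓.P_lt_of_mem_zone hz) hf₁ hf₂ hh
  have hr : |B.rFun x| < T.D.εw := hx.2
  rw [T.gFun_eq_rFun_of_mem_box hx] at hG
  linarith [(abs_lt.1 hr).1, 𝔓.εw_lt]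

/-! ### The recipe on a zone and the modified `Ĝ` -/

/-- **The recipe of the `j`-th zone** (in Milnor's coordinates `u = coord_j x`, `A = qA u`,
`B = qB u`): `k_g (1 - ε_T ρ̂(A) u₀² + (κ_T/η₂) A B) + g₀ - b - (τ'/β) χ₂(A) χ₃(B) u₂/√B`.
[cite: GayKirby2016, §4, Lemma 14] -/
def recipe (j : ι) (x : X) : ℝ :=
  𝔉.kg * (1 - 𝔉.εT * (𝔓.rhoHat (BeltModel.qA ((𝔉.boxes.box j).coord x)) * ((𝔉.boxes.box j).coord x) 0 ^ 2)
      + 𝔉.κT / 𝔉.η₂ * BeltModel.qA ((𝔉.boxes.box j).coord x) * BeltModel.qB ((𝔉.boxes.box j).coord x))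
    + 𝔉.g₀ - B.b
    - 𝔓.τp / 𝔓.β * (𝔓.chi2 (BeltModel.qA ((𝔉.boxes.box j).coord x)) *
      (𝔉.chi3 (BeltModel.qB ((𝔉.boxes.box j).coord x)) * ((𝔉.boxes.box j).coord x) 2 *
        (Real.sqrt (BeltModel.qB ((𝔉.boxes.box j).coord x)))⁻¹))

/-- **Shell agreement**: on the part `{max r₁ r₃ < A_j}` of the zone the recipe is the
transported Heegaard function `G` (there `ρ̂ = 1/A`, `χ₂ = 0`, the point hits, and
`G = k_g 𝒯(coord_j) + g₀ - b`). [cite: GayKirby2016, §4, Lemma 14] -/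
theorem recipe_eq_gFun_of_lt_A {j : ι} {x : X} (hx : x ∈ 𝔓.zone j) (hA : max 𝔓.r₁ 𝔓.r₃ < 𝔉.boxes.A j x) :
    𝔓.recipe j x = B.gFun x := by
  obtain ⟨hr₁, hr₃⟩ := max_lt_iff.1 hA
  have hApos : 0 < 𝔉.boxes.A j x := by linarith [𝔓.r₀_pos, 𝔓.r₀_lt]
  have hh := 𝔓.hit_of_mem_zone_of_A_pos hx hApos
  obtain ⟨hf₁, hf₂⟩ := 𝔓.band_of_mem_zone hx
  rw [𝔉.gFun_eq_of_P_lt hx.1 (𝔓.P_lt_of_mem_zone hx) hf₁ hf₂ hh, TubeModel.tube_apply']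
  set u := (𝔉.boxes.box j).coord x with hu
  have hAq : 𝔉.boxes.A j x = BeltModel.qA u := 𝔉.A_eq_qA j x
  rw [hAq] at hr₁ hr₃ hApos
  rw [recipe, 𝔓.rhoHat_of_ge hr₁.le, 𝔓.chi2_of_ge hr₃.le, BeltModel.qA_apply, BeltModel.qB_apply]
  rw [BeltModel.qA_apply] at hApos
  have hne : u 0 ^ 2 + u 1 ^ 2 ≠ 0 := hApos.ne'
  field_simp
  ring

/-- **The modified transported Heegaard function** `Ĝ`: `G` off the zones, the recipe on them.
[cite: GayKirby2016, §4, Lemma 14] -/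
def Ghat (x : X) : ℝ := B.gFun x + ∑ j, (𝔓.zone j).indicator (fun x => 𝔓.recipe j x - B.gFun x) x

/-- On the `j`-th zone, `Ĝ` is the recipe. [folklore] -/
theorem Ghat_of_mem_zone {j : ι} {x : X} (hx : x ∈ 𝔓.zone j) : 𝔓.Ghat x = 𝔓.recipe j x := by
  unfold Ghat
  rw [Finset.sum_eq_single j]
  · rw [indicator_of_mem hx]; ring
  · intro i _ hij
    rw [indicator_of_notMem]
    exact fun hi => (𝔓.zone_disjoint hij).le_bot ⟨hi, hx⟩
  · intro hj; exact absurd (Finset.mem_univ j) hj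

/-- Off the zones, `Ĝ = G`. [folklore] -/
theorem Ghat_of_forall_not_mem {x : X} (hx : ∀ j, x ∉ 𝔓.zone j) : 𝔓.Ghat x = B.gFun x := by
  unfold Ghat
  rw [Finset.sum_eq_zero fun j _ => indicator_of_notMem (hx j) _, add_zero]

/-- **The Morse function of `H₂₃` (ambient form)**: `F = 1 - α(f - a) + β Ĝ`. [cite: GayKirby2016, §4, Lemma 14] -/
def Famb (x : X) : ℝ := 1 - T.alpha (B.f x - B.a) + 𝔓.β * 𝔓.Ghat x

omit [T2Space X] [CompactSpace X] in
/-- **On the zones the recipe is below `-m₀/2`** (`k_g(1 - ε_T) + g₀ ≤ b - m₀`, the radial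
term is `< k_g (κ_T/η₂) P₀`, the perturbation is `≤ τ'/β`). [cite: GayKirby2016, §4, Lemma 14] -/
theorem recipe_le_of_mem_zone {j : ι} {x : X} (hx : x ∈ 𝔓.zone j) : 𝔓.recipe j x ≤ -(𝔉.m₀ / 2) := by
  set u := (𝔉.boxes.box j).coord x with hu
  have hAq : 𝔉.boxes.A j x = BeltModel.qA u := 𝔉.A_eq_qA j x
  have hBq : 𝔉.boxes.B j x = BeltModel.qB u := 𝔉.B_eq_qB j x
  have hA0 : 0 ≤ BeltModel.qA u := BeltModel.qA_nonneg u
  have hB0 : 0 ≤ BeltModel.qB u := BeltModel.qB_nonneg u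
  have hP : BeltModel.qA u * BeltModel.qB u < 𝔉.P₀ := by
    have := 𝔓.P_lt_of_mem_zone hx
    rwa [HandleBoxes.P_def, hAq, hBq] at this
  have hkg := 𝔉.kg_pos
  have hk₁ : 0 ≤ 𝔉.κT / 𝔉.η₂ := div_nonneg 𝔉.κT_pos.le 𝔉.η₂_pos.le
  have h1 : 0 ≤ 𝔓.rhoHat (BeltModel.qA u) * u 0 ^ 2 := mul_nonneg (𝔓.rhoHat_nonneg hA0) (sq_nonneg _)
  -- the perturbation is bounded by `1` in absolute value
  have hcos : |u 2 * (Real.sqrt (BeltModel.qB u))⁻¹| ≤ 1 := by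
    by_cases hB : BeltModel.qB u = 0
    · rw [hB, Real.sqrt_zero, inv_zero, mul_zero, abs_zero]; exact zero_le_one
    · have hs : 0 < Real.sqrt (BeltModel.qB u) := Real.sqrt_pos.2 (lt_of_le_of_ne hB0 (Ne.symm hB))
      rw [abs_mul, abs_inv, abs_of_pos hs, ← div_eq_mul_inv, div_le_one hs]
      have h2le : u 2 ^ 2 ≤ BeltModel.qB u := by rw [BeltModel.qB_apply]; nlinarith [sq_nonneg (u 3)]
      calc |u 2| = Real.sqrt (u 2 ^ 2) := (Real.sqrt_sq_eq_abs _).symm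
        _ ≤ Real.sqrt (BeltModel.qB u) := Real.sqrt_le_sqrt h2le
  have hc2 := 𝔓.chi2_mem (BeltModel.qA u)
  have hc3 := 𝔉.chi3_mem (BeltModel.qB u)
  have h2 : |𝔓.chi2 (BeltModel.qA u) * (𝔉.chi3 (BeltModel.qB u) * u 2 * (Real.sqrt (BeltModel.qB u))⁻¹)| ≤ 1 := by
    rw [show 𝔓.chi2 (BeltModel.qA u) * (𝔉.chi3 (BeltModel.qB u) * u 2 * (Real.sqrt (BeltModel.qB u))⁻¹) =
      (𝔓.chi2 (BeltModel.qA u) * 𝔉.chi3 (BeltModel.qB u)) * (u 2 * (Real.sqrt (BeltModel.qB u))⁻¹) by ring]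
    rw [abs_mul]
    have hcc : |𝔓.chi2 (BeltModel.qA u) * 𝔉.chi3 (BeltModel.qB u)| ≤ 1 := by
      rw [abs_mul, abs_of_nonneg hc2.1, abs_of_nonneg hc3.1]
      nlinarith [hc2.1, hc2.2, hc3.1, hc3.2]
    calc |𝔓.chi2 (BeltModel.qA u) * 𝔉.chi3 (BeltModel.qB u)| * |u 2 * (Real.sqrt (BeltModel.qB u))⁻¹| ≤ 1 * 1 :=
          mul_le_mul hcc hcos (abs_nonneg _) zero_le_one
      _ = 1 := one_mul _
  have h3 := (abs_le.1 h2).1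
  have hτβ : 0 ≤ 𝔓.τp / 𝔓.β := div_nonneg 𝔓.τp_pos.le 𝔓.β_pos.le
  have h4 : -(𝔓.τp / 𝔓.β * (𝔓.chi2 (BeltModel.qA u) * (𝔉.chi3 (BeltModel.qB u) * u 2 * (Real.sqrt (BeltModel.qB u))⁻¹)))
      ≤ 𝔓.τp / 𝔓.β := by nlinarith
  have h5 : 𝔉.κT / 𝔉.η₂ * BeltModel.qA u * BeltModel.qB u ≤ 𝔉.κT / 𝔉.η₂ * 𝔉.P₀ := by
    rw [mul_assoc]; exact mul_le_mul_of_nonneg_left hP.le hk₁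
  have hsmall := 𝔓.small₀
  have hkgle := 𝔓.kg_g₀_le
  have hεT := 𝔉.εT_nonneg
  have h6 : 𝔉.kg * (1 - 𝔉.εT * (𝔓.rhoHat (BeltModel.qA u) * u 0 ^ 2)
      + 𝔉.κT / 𝔉.η₂ * BeltModel.qA u * BeltModel.qB u) ≤ 𝔉.kg * (1 + 𝔉.κT / 𝔉.η₂ * 𝔉.P₀) := by
    apply mul_le_mul_of_nonneg_left _ hkg.le
    nlinarith [mul_nonneg hεT h1]
  unfold recipe
  nlinarith

/-- **On the zones, `F < 1`.** [cite: GayKirby2016, §4, Lemma 14] -/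
theorem Famb_lt_one_of_mem_zone {j : ι} {x : X} (hx : x ∈ 𝔓.zone j) : 𝔓.Famb x < 1 := by
  have h1 := 𝔓.recipe_le_of_mem_zone hx
  have h2 : T.alpha (B.f x - B.a) = T.αS := by
    apply T.alpha_of_ge
    have h := (𝔓.f_bounds_of_mem_zone hx).1
    have := 𝔓.m₁_le_ε; have := T.ε_pos
    unfold αS ασ; linarith
  rw [Famb, 𝔓.Ghat_of_mem_zone hx, h2]
  have : 0 < T.αS := by have := T.ε_le_sub; have := T.ε_pos; unfold αS; linarith
  have hβ := 𝔓.β_pos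
  have : 𝔓.β * 𝔓.recipe j x ≤ 𝔓.β * (-(𝔉.m₀ / 2)) := mul_le_mul_of_nonneg_left h1 hβ.le
  nlinarith [𝔉.lt_m₀, T.ε_pos]

/-! ### Smoothness -/

omit [T2Space X] [CompactSpace X] in
/-- **The recipe is smooth on the chart domain.** [folklore] -/
theorem contMDiffAt_recipe {j : ι} {x : X} (hx : x ∈ (𝔉.boxes.box j).chart.source) :
    ContMDiffAt (𝓡 4) 𝓘(ℝ, ℝ) ∞ (𝔓.recipe j) x := by
  have hc := 𝔉.contMDiffAt_coord hx
  -- the model function is smooth on `ℝ⁴`: the `χ₃`-term kills the singularity of `u₂/√B`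
  have hmodel : ContDiff ℝ ∞ fun u : EuclideanSpace ℝ (Fin 4) =>
      𝔉.kg * (1 - 𝔉.εT * (𝔓.rhoHat (BeltModel.qA u) * u 0 ^ 2) + 𝔉.κT / 𝔉.η₂ * BeltModel.qA u * BeltModel.qB u)
        + 𝔉.g₀ - B.b
        - 𝔓.τp / 𝔓.β * (𝔓.chi2 (BeltModel.qA u) * (𝔉.chi3 (BeltModel.qB u) * u 2 * (Real.sqrt (BeltModel.qB u))⁻¹)) := by
    have hA : ContDiff ℝ ∞ BeltModel.qA := BeltModel.contDiff_qA
    have hB : ContDiff ℝ ∞ BeltModel.qB := BeltModel.contDiff_qB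
    have h0 : ContDiff ℝ ∞ fun u : EuclideanSpace ℝ (Fin 4) => u 0 := contDiff_piLp_apply (p := 2) (i := (0 : Fin 4))
    have h2 : ContDiff ℝ ∞ fun u : EuclideanSpace ℝ (Fin 4) => u 2 := contDiff_piLp_apply (p := 2) (i := (2 : Fin 4))
    -- the perturbation term
    have hpert : ContDiff ℝ ∞ fun u : EuclideanSpace ℝ (Fin 4) =>
        𝔉.chi3 (BeltModel.qB u) * u 2 * (Real.sqrt (BeltModel.qB u))⁻¹ := by
      refine contDiff_iff_contDiffAt.2 fun u => ?_
      rcases lt_or_ge (BeltModel.qB u) (𝔉.ν ^ 2 / 4) with h | h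
      · -- near `u`, `χ₃(B) = 0`
        have hev : (fun u : EuclideanSpace ℝ (Fin 4) => 𝔉.chi3 (BeltModel.qB u) * u 2 * (Real.sqrt (BeltModel.qB u))⁻¹)
            =ᶠ[𝓝 u] fun _ => 0 := by
          filter_upwards [(isOpen_lt hB.continuous continuous_const).mem_nhds h] with v hv
          have hv' : BeltModel.qB v ≤ 𝔉.ν ^ 2 / 4 := le_of_lt hv
          rw [𝔉.chi3_of_le hv']
          ring
        exact contDiffAt_const.congr_of_eventuallyEq hev
      · have hBpos : 0 < BeltModel.qB u := by
          have := 𝔉.ν_pos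
          have : 0 < 𝔉.ν ^ 2 / 4 := by positivity
          linarith
        have hB0 : BeltModel.qB u ≠ 0 := hBpos.ne'
        have hsqrt : ContDiffAt ℝ ∞ (fun u => (Real.sqrt (BeltModel.qB u))⁻¹) u :=
          (hB.contDiffAt.sqrt hB0).inv (Real.sqrt_ne_zero'.2 hBpos)
        exact ((𝔉.contDiff_chi3.contDiffAt.comp u hB.contDiffAt).mul h2.contDiffAt).mul hsqrt
    have hmain : ContDiff ℝ ∞ fun u : EuclideanSpace ℝ (Fin 4) =>
        𝔉.kg * (1 - 𝔉.εT * (𝔓.rhoHat (BeltModel.qA u) * u 0 ^ 2) + 𝔉.κT / 𝔉.η₂ * BeltModel.qA u * BeltModel.qB u)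
          + 𝔉.g₀ - B.b :=
      ((contDiff_const.mul ((contDiff_const.sub (contDiff_const.mul ((𝔓.contDiff_rhoHat.comp hA).mul (h0.pow 2)))).add
        ((contDiff_const.mul hA).mul hB))).add contDiff_const).sub contDiff_const
    exact hmain.sub (contDiff_const.mul ((𝔓.contDiff_chi2.comp hA).mul hpert))
  have hfun : 𝔓.recipe j = (fun u : EuclideanSpace ℝ (Fin 4) =>
      𝔉.kg * (1 - 𝔉.εT * (𝔓.rhoHat (BeltModel.qA u) * u 0 ^ 2) + 𝔉.κT / 𝔉.η₂ * BeltModel.qA u * BeltModel.qB u)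
        + 𝔉.g₀ - B.b
        - 𝔓.τp / 𝔓.β * (𝔓.chi2 (BeltModel.qA u) * (𝔉.chi3 (BeltModel.qB u) * u 2 * (Real.sqrt (BeltModel.qB u))⁻¹))) ∘
      (𝔉.boxes.box j).coord := rfl
  rw [hfun]
  exact hmodel.contMDiff.contMDiffAt.comp x hc

/-- On the `j`-th zone, `Ĝ` is eventually the recipe. [folklore] -/
theorem Ghat_eventuallyEq_recipe {j : ι} {x : X} (hx : x ∈ 𝔓.zone j) : 𝔓.Ghat =ᶠ[𝓝 x] 𝔓.recipe j := by
  filter_upwards [(𝔓.isOpen_zone j).mem_nhds hx] with y hy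
  exact 𝔓.Ghat_of_mem_zone hy

/-- `Ĝ` is smooth on the zones. [folklore] -/
theorem contMDiffAt_Ghat_of_mem_zone {j : ι} {x : X} (hx : x ∈ 𝔓.zone j) :
    ContMDiffAt (𝓡 4) 𝓘(ℝ, ℝ) ∞ 𝔓.Ghat x :=
  (𝔓.contMDiffAt_recipe hx.1).congr_of_eventuallyEq (𝔓.Ghat_eventuallyEq_recipe hx)

/-- **Off the zones, near a point of `H₂₃ ∖ X₁`, each correction term vanishes identically.**
For `p ∈ H₂₃ ∖ X₁` outside the `j`-th zone: either `p ∉ source_j` (and the zone is away from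
`p`), or `A_j p ≥ a_R > max r₁ r₃` (the other alternatives `A_j p < a_R` would put `p`, which
has `f p = c` by `TubeFrame.f_eq_c_of_mem_H₂₃_of_P_lt`, in the zone), and then near `p` the
shell agreement makes the term vanish. [cite: GayKirby2016, §4, Lemma 14] -/
theorem indicator_eventuallyEq_zero {p : X} (hH : p ∈ T.H₂₃) (hp₁ : p ∉ T.X₁) {j : ι} (hpj : p ∉ 𝔓.zone j) :
    (𝔓.zone j).indicator (fun x => 𝔓.recipe j x - B.gFun x) =ᶠ[𝓝 p] fun _ => 0 := by
  by_cases hsrc : p ∈ (𝔉.boxes.box j).chart.source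
  · -- `A_j p ≥ a_R`
    have hA : 𝔓.aR ≤ 𝔉.boxes.A j p := by
      by_contra hlt
      push Not at hlt
      have hP : 𝔉.boxes.P j p < 𝔉.P₀ := by
        have hA0 := 𝔉.boxes.A_nonneg j p
        have hB := 𝔉.B_le_of_mem_H₂₃ hH hsrc
        rw [HandleBoxes.P_def]
        calc 𝔉.boxes.A j p * 𝔉.boxes.B j p ≤ 𝔉.boxes.A j p * (𝔉.ν ^ 2 + 𝔉.boxes.A j p) :=
              mul_le_mul_of_nonneg_left hB hA0
          _ < 𝔓.aR * (𝔉.ν ^ 2 + 𝔓.m₁ + 𝔓.aR) := by nlinarith [𝔉.ν_pos, 𝔓.m₁_pos]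
          _ ≤ 𝔉.P₀ := 𝔓.aR_P
      have hfc := 𝔉.f_eq_c_of_mem_H₂₃_of_P_lt hH hp₁ hsrc hP
      exact hpj ⟨hsrc, hlt, by rw [hfc, sub_self, abs_zero]; exact 𝔓.m₁_pos⟩
    have hlt : max 𝔓.r₁ 𝔓.r₃ < 𝔉.boxes.A j p := lt_of_lt_of_le (max_lt 𝔓.r₁_lt 𝔓.r₃_lt) hA
    -- near `p`: in `source_j` with `A_j > max r₁ r₃`
    have hev : ∀ᶠ x in 𝓝 p, x ∈ (𝔉.boxes.box j).chart.source ∧ max 𝔓.r₁ 𝔓.r₃ < 𝔉.boxes.A j x := by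
      have hc : ContinuousAt (𝔉.boxes.A j) p :=
        (𝔉.boxes.continuousOn_A j).continuousAt ((𝔉.boxes.box j).chart.open_source.mem_nhds hsrc)
      have h1 : ∀ᶠ x in 𝓝 p, x ∈ (𝔉.boxes.box j).chart.source := (𝔉.boxes.box j).chart.open_source.mem_nhds hsrc
      have h2 : ∀ᶠ x in 𝓝 p, 𝔉.boxes.A j x ∈ Ioi (max 𝔓.r₁ 𝔓.r₃) := hc.eventually (isOpen_Ioi.mem_nhds hlt)
      exact h1.and h2
    filter_upwards [hev] with x hx
    by_cases hxz : x ∈ 𝔓.zone j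
    · rw [indicator_of_mem hxz, 𝔓.recipe_eq_gFun_of_lt_A hxz hx.2, sub_self]
    · rw [indicator_of_notMem hxz]
  · filter_upwards [𝔓.eventually_not_mem_zone_of_not_mem_source hsrc] with x hx
    rw [indicator_of_notMem hx]

/-- **Off the zones, near a point of `H₂₃ ∖ X₁`, `Ĝ = G`.** [cite: GayKirby2016, §4, Lemma 14] -/
theorem Ghat_eventuallyEq_gFun {p : X} (hH : p ∈ T.H₂₃) (hp₁ : p ∉ T.X₁) (hp : ∀ j, p ∉ 𝔓.zone j) :
    𝔓.Ghat =ᶠ[𝓝 p] B.gFun := by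
  have hall : ∀ᶠ x in 𝓝 p, ∀ j, (𝔓.zone j).indicator (fun x => 𝔓.recipe j x - B.gFun x) x = 0 := by
    rw [eventually_all]
    exact fun j => 𝔓.indicator_eventuallyEq_zero hH hp₁ (hp j)
  filter_upwards [hall] with x hx
  unfold Ghat
  rw [Finset.sum_eq_zero fun j _ => hx j, add_zero]

/-- **On the bi-collar box, `Ĝ = G`** (the box misses the zones). [folklore] -/
theorem Ghat_eventuallyEq_gFun_of_mem_box {p : X} (hp : p ∈ B.box T.D.εw) : 𝔓.Ghat =ᶠ[𝓝 p] B.gFun := by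
  filter_upwards [(B.isOpen_box T.D.εw_le_δU).mem_nhds hp] with x hx
  exact 𝔓.Ghat_of_forall_not_mem (𝔓.not_mem_zone_of_mem_box hx)

/-- **`Ĝ` is smooth at every point of `H₂₃`.** [cite: GayKirby2016, §4, Lemma 14] -/
theorem contMDiffAt_Ghat_of_mem_H₂₃ (hc2 : B.a + B.U.δ + 2 * T.ε ≤ T.c) {p : X} (hH : p ∈ T.H₂₃) :
    ContMDiffAt (𝓡 4) 𝓘(ℝ, ℝ) ∞ 𝔓.Ghat p := by
  by_cases hb : p ∈ B.box T.D.εw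
  · exact (T.Fr.contMDiffAt_gFun (T.hit_of_mem_box hb)).congr_of_eventuallyEq (𝔓.Ghat_eventuallyEq_gFun_of_mem_box hb)
  · have hp₁ : p ∉ T.X₁ := T.not_mem_X₁_of_mem_H₂₃_of_not_mem_box hc2 hH hb
    by_cases hz : ∃ j, p ∈ 𝔓.zone j
    · obtain ⟨j, hj⟩ := hz
      exact 𝔓.contMDiffAt_Ghat_of_mem_zone hj
    · push Not at hz
      have hh : B.Hit p := by
        by_contra hnh
        obtain ⟨j, hj, -⟩ := 𝔓.exists_mem_zone_of_not_hit hH hp₁ hnh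
        exact hz j hj
      exact (T.Fr.contMDiffAt_gFun hh).congr_of_eventuallyEq (𝔓.Ghat_eventuallyEq_gFun hH hp₁ hz)

/-- **The Morse function of `H₂₃` is smooth at every point of `H₂₃`.** [cite: GayKirby2016, §4, Lemma 14] -/
theorem contMDiffAt_Famb_of_mem_H₂₃ (hc2 : B.a + B.U.δ + 2 * T.ε ≤ T.c) {p : X} (hH : p ∈ T.H₂₃) :
    ContMDiffAt (𝓡 4) 𝓘(ℝ, ℝ) ∞ 𝔓.Famb p := by
  have hf : ContMDiffAt (𝓡 4) 𝓘(ℝ, ℝ) ∞ (fun x => B.f x - B.a) p :=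
    B.U.contMDiff_f.contMDiffAt.sub contMDiffAt_const
  have hα : ContMDiffAt (𝓡 4) 𝓘(ℝ, ℝ) ∞ (fun x => T.alpha (B.f x - B.a)) p :=
    T.contDiff_alpha.contMDiff.contMDiffAt.comp p hf
  unfold Famb
  exact (contMDiffAt_const.sub hα).add (contMDiffAt_const.mul (𝔓.contMDiffAt_Ghat_of_mem_H₂₃ hc2 hH))

/-! ### The reading in Milnor's chart -/

/-- The constant of the reading of `F` in the `j`-th chart. [folklore] -/
def chartConst : ℝ := 1 - T.αS + 𝔓.β * (𝔉.kg + 𝔉.g₀ - B.b)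

omit [T2Space X] [CompactSpace X] in
/-- On the zone, `α(f - a)` is on its plateau: `α = S`. [folklore] -/
theorem alpha_eq_of_mem_zone {j : ι} {x : X} (hx : x ∈ 𝔓.zone j) : T.alpha (B.f x - B.a) = T.αS := by
  apply T.alpha_of_ge
  have h := (𝔓.f_bounds_of_mem_zone hx).1
  have := 𝔓.m₁_le_ε
  have := T.ε_pos
  unfold αS ασ
  linarith

/-- **The reading of `F` in Milnor's chart on the zone, above `B = ν²/2`**:
`F x = C + belt (β k_g) ε_T (κ_T/η₂) τ' ρ̂ χ₂ (coord_j x)`, the belt function of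
`TrisectionsBeltModel.lean`. [cite: GayKirby2016, §4, Lemma 14] -/
theorem Famb_eq_of_mem_zone {j : ι} {x : X} (hx : x ∈ 𝔓.zone j)
    (hB : 𝔉.ν ^ 2 / 2 ≤ BeltModel.qB ((𝔉.boxes.box j).coord x)) :
    𝔓.Famb x = 𝔓.chartConst +
      BeltModel.belt (𝔓.β * 𝔉.kg) 𝔉.εT (𝔉.κT / 𝔉.η₂) 𝔓.τp 𝔓.rhoHat 𝔓.chi2 ((𝔉.boxes.box j).coord x) := by
  rw [Famb, 𝔓.alpha_eq_of_mem_zone hx, 𝔓.Ghat_of_mem_zone hx, recipe, 𝔉.chi3_of_ge hB, chartConst,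
    BeltModel.belt]
  have hβ := 𝔓.β_pos.ne'
  field_simp
  ring

/-- The same, through the chart: for `z` in the image of the zone (above `B = ν²/2`),
`F (e⁻¹ z) = C + belt … (z - e c_j)`. [cite: GayKirby2016, §4, Lemma 14] -/
theorem Famb_comp_symm_apply {j : ι} {z : EuclideanSpace ℝ (Fin 4)}
    (hz : z ∈ (𝔉.boxes.box j).chart.target) (hzone : (𝔉.boxes.box j).chart.symm z ∈ 𝔓.zone j)
    (hB : 𝔉.ν ^ 2 / 2 ≤ BeltModel.qB (z - (𝔉.boxes.box j).chart (𝔉.boxes.cpt j))) :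
    𝔓.Famb ((𝔉.boxes.box j).chart.symm z) = 𝔓.chartConst +
      BeltModel.belt (𝔓.β * 𝔉.kg) 𝔉.εT (𝔉.κT / 𝔉.η₂) 𝔓.τp 𝔓.rhoHat 𝔓.chi2
        (z - (𝔉.boxes.box j).chart (𝔉.boxes.cpt j)) := by
  have hcoord : (𝔉.boxes.box j).coord ((𝔉.boxes.box j).chart.symm z) = z - (𝔉.boxes.box j).chart (𝔉.boxes.cpt j) := by
    simp only [MilnorBox.coord, OpenPartialHomeomorph.extend_coe, modelWithCornersSelf_coe, comp_apply, id_eq]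
    rw [(𝔉.boxes.box j).chart.right_inv hz]
  rw [𝔓.Famb_eq_of_mem_zone hzone (by rw [hcoord]; exact hB), hcoord]


end BeltParams

end TubeFrame

end TriData

end BiCollar

end Literature.Topology.FourManifolds

end
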